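import Summits.BirchSwinnertonDyer.BirchSwinnertonDyer.Theorems.KolyvaginRoadThreeSchneiderTamAtThreeHeightLogNumeratorSplit
import HarnessLib

/-!
# The split `p`-adic height — the generic FIRST-ORDER SPLIT ROW CHECKER at `p ≥ 5`:
# `p^α ∥ (num x)^{p−1} − 1`, `p^{v_L} ∥ U^{p−1} − c₄^{6(p−1)}`, **`α + v_L ≠ v_p(den x)`** ⟹ `ĥ_p^{split}(Q) ≠ 0`
# for every Tate parameter, and the certificate `RegMult.CertSplit W p Q 1`

HONEST FRAMING (cell `bsd-stepL`, seat `bsd-stepL-tam3-p2` g4; `--supports stmt-BirchSwinnertonDyer-19154 --as helper`):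
THEOREMS ONLY, route-free; 0 definitions, 0 named facts, 0 sorry; ONE curve per application, every hypothesis an
integer (non-)divisibility or gcd decided by `norm_num`. Nothing class-wide is claimed; Schneider's conjecture and
BSD are asserted nowhere. Continuation of `…HeightLogNumeratorSplit.lean` (the split law in norm + `‖log_p q_E‖`
from the integer model). Consumers: the split REGMULT-PAIR rows (D-f of the cell: 961 split ∧ (ram) X11b@3
classes at `p = 3` — file `…SplitThree`; the K2 universes at `p ≥ 5`), in the currency
`RegMult.CertSplit W p Q m` of `X11b/RegMultCertificateJoin.lean` (e.g. the exz-road rung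
`ExceptionalZeroRoad.stub_rung_res_8085y1_of_split_of_certSplit`, p548212).

* `heightSplitCoord_ne_zero_of_row_padic` — for `W = ⟨a₁,…,a₆⟩` globally minimal, multiplicative at `p ≥ 5`,
  the rational point `Q = (a/e², b/e³)` ON the curve with `e = p^k e'`, `k ≥ 1`, `p ∤ e'`, `gcd(a, e) = 1`, the
  integer data `c₄`, `Δ = p^νΔ'` (`p ∤ c₄Δ'`), `U = Δ'c₄³ + 744p^νΔ'²`, `p^{v_L} ∥ U^{p−1} − c₄^{6(p−1)}`,
  `v_L < 2ν`, `p^α ∥ a^{p−1} − 1` and **`α + v_L ≠ 2k`**: `heightSplitCoord W p q x(Q) y(Q) ≠ 0` for EVERY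
  `q ≠ 0`, `‖q‖ < 1`, `j(q) = j(W)`.
* `certSplit_of_row_padic` — plus the gcd test of lane A's `KernelCert` (non-singular reduction at every prime)
  ⟹ `RegMult.CertSplit W p Q 1` (admissible `Q`, split height `≠ 0` for every `TateParameterData`).
* `schneiderHalf_split_of_row_padic` — in Mordell–Weil rank one, the `.2` (split) half of
  `ClassClosure.RegulatorNonvanishingAt W p` (`RegMult.schneiderHalf_split_of_cert`).

References: [SteinWuthrich2013] §4.2 (p. 16); [SilvermanAEC2009] VII.2.1 (gcd test), III.1; [SilvermanATAEC1994]
Thm. V.3.1(b), Lemma V.5.1; [Iwasawa1972PadicL] §4.4; [MazurSteinTate2006] §1.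
-/

noncomputable section

open scoped Classical
open Filter Topology IsUltrametricDist
open WeierstrassCurve Literature.NumberTheory.EllipticCurves
open Literature.NumberTheory.EllipticCurves.SteinWuthrich2013
open Literature.NumberTheory.EllipticCurves.TateCurve
open Literature.NumberTheory.EllipticCurves.Rank1Residual
open Summit.BirchSwinnertonDyer.Uniform.UI.O2
open Summit.BirchSwinnertonDyer.Rank1Residual Summit.BirchSwinnertonDyer.Rank1Residual.X11b

namespace Summit.BirchSwinnertonDyer.Rank1Residual.X11b.RegMult.HeightLogNumerator

variable {p : ℕ} [Fact p.Prime]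

/-! ### §4 The row checker -/

section RowChecker

/-- **Generic FIRST-ORDER SPLIT ROW CHECKER at `p ≥ 5` (value form).** See the module docstring for the
hypotheses bundled in `H`; conclusion: the split height of SW 2013 §4.2 at the point `(x, y) = (a/e², b/e³)` is
non-zero for every Tate parameter `q` of `W` at `p`. Mechanism: `‖log_p a‖ = p^{−α}`, `‖x‖⁻¹ = p^{−2k}`,
`‖log_p q‖ = p^{−v_L}` (`norm_padicLog_tateParam_eq_of_model`), and `α ≠ 2k − v_L` is the hypothesis `hne` of
`heightSplitCoord_ne_zero_of_norm_ne_padic`. [cite: SteinWuthrich2013, §4.2] [cite: Iwasawa1972PadicL, §4.4] -/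
theorem heightSplitCoord_ne_zero_of_row_padic (hp5 : 5 ≤ p) (W : WeierstrassCurve ℚ) {a₁ a₂ a₃ a₄ a₆ : ℤ}
    (hW : W = ⟨a₁, a₂, a₃, a₄, a₆⟩) [W.IsElliptic] [W.IsGloballyMinimal] (hWm : Mult W p)
    {a c4 Dp U NL : ℤ} {e' k ν vL α : ℕ}
    (H : ¬ p ∣ e' ∧ 1 ≤ k ∧ Nat.Coprime a.natAbs (p ^ k * e') ∧
      c4 = (a₁ ^ 2 + 4 * a₂) ^ 2 - 24 * (2 * a₄ + a₁ * a₃) ∧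
      (p : ℤ) ^ ν * Dp = -(a₁ ^ 2 + 4 * a₂) ^ 2 * (a₁ ^ 2 * a₆ + 4 * a₂ * a₆ - a₁ * a₃ * a₄ + a₂ * a₃ ^ 2 - a₄ ^ 2) -
        8 * (2 * a₄ + a₁ * a₃) ^ 3 - 27 * (a₃ ^ 2 + 4 * a₆) ^ 2 +
        9 * (a₁ ^ 2 + 4 * a₂) * (2 * a₄ + a₁ * a₃) * (a₃ ^ 2 + 4 * a₆) ∧
      ¬ (p : ℤ) ∣ c4 ∧ ¬ (p : ℤ) ∣ Dp ∧
      U = Dp * c4 ^ 3 + 744 * (p : ℤ) ^ ν * Dp ^ 2 ∧ NL = U ^ (p - 1) - c4 ^ (6 * (p - 1)) ∧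
      (p : ℤ) ^ vL ∣ NL ∧ ¬ (p : ℤ) ^ (vL + 1) ∣ NL ∧ vL < 2 * ν ∧
      (p : ℤ) ^ α ∣ a ^ (p - 1) - 1 ∧ ¬ (p : ℤ) ^ (α + 1) ∣ a ^ (p - 1) - 1 ∧ α + vL ≠ 2 * k)
    {x y : ℚ} (hx : x = a / ((p ^ k * e' : ℕ) : ℚ) ^ 2) (hP : W.toAffine.Equation x y)
    {q : ℚ_[p]} (hq0 : q ≠ 0) (hq : ‖q‖ < 1) (hj : tateJ q = (W.j : ℚ_[p])) :
    heightSplitCoord W p q x y ≠ 0 := by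
  obtain ⟨hpe', hk, hcop, hc4, hD, hpc4, hpDp, hU, hNL, h1, h2, hvL, hα1, hα2, hcrit⟩ := H
  have hpP : p.Prime := Fact.out
  have hp2 : p ≠ 2 := by omega
  have hp1 : (1 : ℝ) < p := by exact_mod_cast hpP.one_lt
  have hpR0 : (p : ℝ) ≠ 0 := by positivity
  have he'0 : e' ≠ 0 := by rintro rfl; exact hpe' (dvd_zero p)
  have he0 : (p ^ k * e' : ℕ) ≠ 0 := Nat.mul_ne_zero (pow_ne_zero _ hpP.ne_zero) he'0
  have hpe : p ∣ p ^ k * e' := dvd_mul_of_dvd_left (dvd_pow_self p (by omega)) _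
  have h : W.toAffine.Nonsingular x y :=
    (WeierstrassCurve.Affine.equation_iff_nonsingular (W := W.toAffine)).mp hP
  have hx1 : 1 < ‖(x : ℚ_[p])‖ :=
    (one_lt_norm_ratCast_iff p x).mpr (KernelCert.padicValRat_x_neg he0 hx hcop hpe)
  -- `p ∤ a`
  have hpa : ¬ (p : ℤ) ∣ a := by
    intro hd
    have h1' : p ∣ a.natAbs := Int.natCast_dvd.mp hd
    have h2' : p ∣ Nat.gcd a.natAbs (p ^ k * e') := Nat.dvd_gcd h1' hpe
    rw [hcop] at h2'
    exact hpP.one_lt.ne' (Nat.dvd_one.mp h2')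
  -- `num x = a`, `‖x‖⁻¹ = p^{−2k}`
  set e : ℕ := p ^ k * e' with hedef
  have hcop2 : Nat.Coprime a.natAbs (((e : ℤ) ^ 2).natAbs) := by
    rw [Int.natAbs_pow, Int.natAbs_natCast]; exact hcop.pow_right 2
  have he2pos : (0 : ℤ) < (e : ℤ) ^ 2 := by positivity
  have hxq : x = ((a : ℤ) : ℚ) / (((e : ℤ) ^ 2 : ℤ) : ℚ) := by rw [hx]; push_cast; ring
  have hnum : x.num = a := by rw [hxq]; exact Rat.num_div_eq_of_coprime he2pos hcop2
  have hxinv : ‖(x : ℚ_[p])‖⁻¹ = (p : ℝ) ^ (-((2 * k : ℕ) : ℤ)) := by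
    have hxp : (x : ℚ_[p]) = (a : ℚ_[p]) / ((p : ℚ_[p]) ^ k * (e' : ℚ_[p])) ^ 2 := by
      rw [hx, hedef]; push_cast; ring
    have he'n : ‖(e' : ℚ_[p])‖ = 1 := by
      rw [show (e' : ℚ_[p]) = ((e' : ℤ) : ℚ_[p]) by norm_cast]
      exact BinaryQuartic.norm_intCast_eq_one (fun hd => hpe' (by exact_mod_cast hd))
    rw [hxp, norm_div, BinaryQuartic.norm_intCast_eq_one hpa, norm_pow, norm_mul, norm_pow, Padic.norm_p, he'n,
      mul_one, one_div, inv_inv, ← zpow_natCast, ← zpow_natCast, ← zpow_mul, inv_zpow']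
    congr 1; push_cast; ring
  -- `‖log_p num x‖ = p^{−α}`
  have hla : ‖padicLog p ((x.num : ℚ) : ℚ_[p])‖ = (p : ℝ) ^ (-(α : ℤ)) := by
    rw [hnum, Rat.cast_intCast, norm_padicLog_intCast_eq hp2 hpa]
    have e1 : ((a : ℚ_[p])) ^ (p - 1) - 1 = ((a ^ (p - 1) - 1 : ℤ) : ℚ_[p]) := by push_cast; ring
    rw [e1, GaloisImage.PadicSquareClass.norm_intCast_padic_eq hα1 hα2]
  -- `‖log_p q‖ = p^{−v_L}`
  have hL : ‖padicLog p q‖ = (p : ℝ) ^ (-(vL : ℤ)) :=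
    norm_padicLog_tateParam_eq_of_model hp2 W hW hc4 hD hpc4 hpDp hU hNL h1 h2 hvL hq0 hq hj
  have hL0 : padicLog p q ≠ 0 := norm_pos_iff.mp (by rw [hL]; positivity)
  refine heightSplitCoord_ne_zero_of_norm_ne_padic hp5 hWm hq0 hq hL0 h hx1 ?_
  rw [hla, hxinv, hL, ← zpow_sub₀ hpR0]
  intro heq
  have := zpow_right_injective₀ (by positivity) hp1.ne' heq
  push_cast at this
  omega

/-- **`RegMult.CertSplit W p Q 1` from the row checker** (`Q = (a/e², b/e³)` with the gcd admissibility test: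
`gcd(Φ_y(Q)·e³, Φ_x(Q)·e⁴) ∣ eⁿ`, lane A's `KernelCert.hasNonsingularReductionAt_of_gcd`; `p ≥ 5`): `Q` is
admissible (`isAdmissible_of_one_lt_norm`) and its split height is non-zero for every `TateParameterData W p`.
ONE curve per application; nothing class-wide. [cite: SteinWuthrich2013, §4.2] [cite: SilvermanAEC2009, VII.2.1]
[cite: MazurSteinTate2006, §1] -/
theorem certSplit_of_row_padic (hp5 : 5 ≤ p) (W : WeierstrassCurve ℚ) {a₁ a₂ a₃ a₄ a₆ : ℤ}
    (hW : W = ⟨a₁, a₂, a₃, a₄, a₆⟩) [W.IsElliptic] [W.IsGloballyMinimal] (hWm : Mult W p)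
    {a b c4 Dp U NL : ℤ} {e' k n ν vL α : ℕ}
    (H : ¬ p ∣ e' ∧ 1 ≤ k ∧ Nat.Coprime a.natAbs (p ^ k * e') ∧
      Int.gcd (2 * b + a₁ * a * (p ^ k * e' : ℕ) + a₃ * (p ^ k * e' : ℕ) ^ 3)
        (a₁ * b * (p ^ k * e' : ℕ) - (3 * a ^ 2 + 2 * a₂ * a * (p ^ k * e' : ℕ) ^ 2 + a₄ * (p ^ k * e' : ℕ) ^ 4))
        ∣ (p ^ k * e') ^ n ∧
      c4 = (a₁ ^ 2 + 4 * a₂) ^ 2 - 24 * (2 * a₄ + a₁ * a₃) ∧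
      (p : ℤ) ^ ν * Dp = -(a₁ ^ 2 + 4 * a₂) ^ 2 * (a₁ ^ 2 * a₆ + 4 * a₂ * a₆ - a₁ * a₃ * a₄ + a₂ * a₃ ^ 2 - a₄ ^ 2) -
        8 * (2 * a₄ + a₁ * a₃) ^ 3 - 27 * (a₃ ^ 2 + 4 * a₆) ^ 2 +
        9 * (a₁ ^ 2 + 4 * a₂) * (2 * a₄ + a₁ * a₃) * (a₃ ^ 2 + 4 * a₆) ∧
      ¬ (p : ℤ) ∣ c4 ∧ ¬ (p : ℤ) ∣ Dp ∧
      U = Dp * c4 ^ 3 + 744 * (p : ℤ) ^ ν * Dp ^ 2 ∧ NL = U ^ (p - 1) - c4 ^ (6 * (p - 1)) ∧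
      (p : ℤ) ^ vL ∣ NL ∧ ¬ (p : ℤ) ^ (vL + 1) ∣ NL ∧ vL < 2 * ν ∧
      (p : ℤ) ^ α ∣ a ^ (p - 1) - 1 ∧ ¬ (p : ℤ) ^ (α + 1) ∣ a ^ (p - 1) - 1 ∧ α + vL ≠ 2 * k)
    {x y : ℚ} (hx : x = a / ((p ^ k * e' : ℕ) : ℚ) ^ 2) (hy : y = b / ((p ^ k * e' : ℕ) : ℚ) ^ 3)
    (h : W.toAffine.Nonsingular x y) :
    RegMult.CertSplit W p (.some x y h) 1 := by
  obtain ⟨hpe', hk, hcop, hgcd, hc4, hD, hpc4, hpDp, hU, hNL, h1, h2, hvL, hα1, hα2, hcrit⟩ := H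
  have hpP : p.Prime := Fact.out
  have he'0 : e' ≠ 0 := by rintro rfl; exact hpe' (dvd_zero p)
  have he0 : (p ^ k * e' : ℕ) ≠ 0 := Nat.mul_ne_zero (pow_ne_zero _ hpP.ne_zero) he'0
  have hpe : p ∣ p ^ k * e' := dvd_mul_of_dvd_left (dvd_pow_self p (by omega)) _
  have hx1 : 1 < ‖(x : ℚ_[p])‖ :=
    (one_lt_norm_ratCast_iff p x).mpr (KernelCert.padicValRat_x_neg he0 hx hcop hpe)
  have hadm : W.IsAdmissible p (.some x y h) :=
    isAdmissible_of_one_lt_norm (by omega) h hx1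
      (KernelCert.hasNonsingularReductionAt_of_gcd W hW he0 hx hy hcop hgcd)
  refine ⟨by rw [one_nsmul]; exact hadm, fun Dq => ?_⟩
  rw [one_nsmul]
  show heightSplitCoord W p Dq.q x y ≠ 0
  exact heightSplitCoord_ne_zero_of_row_padic hp5 W hW hWm
    ⟨hpe', hk, hcop, hc4, hD, hpc4, hpDp, hU, hNL, h1, h2, hvL, hα1, hα2, hcrit⟩ hx h.left
    Dq.q_ne_zero Dq.norm_q_lt_one Dq.tateJ_eq

/-- **The `.2` (split) half of `ClassClosure.RegulatorNonvanishingAt W p` from one row, in Mordell–Weil rank one**: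
`RegMult.schneiderHalf_split_of_cert` on `certSplit_of_row_padic`. (On a split curve the `.1` half asks for the
(4.1) height; it is served by the seat's non-split numerator criterion `p^{2k} ∤ a^{p−1} − 1` — automatic when
`α < 2k − v_L` — through `RegMult.schneiderHalf_nonsplit_of_cert`.) ONE curve; modulo the rank hypothesis.
[cite: SteinWuthrich2013, §4.2] [cite: Schneider1982PadicHeightI, §1] -/
theorem schneiderHalf_split_of_row_padic (hp5 : 5 ≤ p) (W : WeierstrassCurve ℚ) {a₁ a₂ a₃ a₄ a₆ : ℤ}
    (hW : W = ⟨a₁, a₂, a₃, a₄, a₆⟩) [W.IsElliptic] [W.IsGloballyMinimal] (hWm : Mult W p)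
    (hr : W.mordellWeilRank = 1) {a b c4 Dp U NL : ℤ} {e' k n ν vL α : ℕ}
    (H : ¬ p ∣ e' ∧ 1 ≤ k ∧ Nat.Coprime a.natAbs (p ^ k * e') ∧
      Int.gcd (2 * b + a₁ * a * (p ^ k * e' : ℕ) + a₃ * (p ^ k * e' : ℕ) ^ 3)
        (a₁ * b * (p ^ k * e' : ℕ) - (3 * a ^ 2 + 2 * a₂ * a * (p ^ k * e' : ℕ) ^ 2 + a₄ * (p ^ k * e' : ℕ) ^ 4))
        ∣ (p ^ k * e') ^ n ∧
      c4 = (a₁ ^ 2 + 4 * a₂) ^ 2 - 24 * (2 * a₄ + a₁ * a₃) ∧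
      (p : ℤ) ^ ν * Dp = -(a₁ ^ 2 + 4 * a₂) ^ 2 * (a₁ ^ 2 * a₆ + 4 * a₂ * a₆ - a₁ * a₃ * a₄ + a₂ * a₃ ^ 2 - a₄ ^ 2) -
        8 * (2 * a₄ + a₁ * a₃) ^ 3 - 27 * (a₃ ^ 2 + 4 * a₆) ^ 2 +
        9 * (a₁ ^ 2 + 4 * a₂) * (2 * a₄ + a₁ * a₃) * (a₃ ^ 2 + 4 * a₆) ∧
      ¬ (p : ℤ) ∣ c4 ∧ ¬ (p : ℤ) ∣ Dp ∧
      U = Dp * c4 ^ 3 + 744 * (p : ℤ) ^ ν * Dp ^ 2 ∧ NL = U ^ (p - 1) - c4 ^ (6 * (p - 1)) ∧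
      (p : ℤ) ^ vL ∣ NL ∧ ¬ (p : ℤ) ^ (vL + 1) ∣ NL ∧ vL < 2 * ν ∧
      (p : ℤ) ^ α ∣ a ^ (p - 1) - 1 ∧ ¬ (p : ℤ) ^ (α + 1) ∣ a ^ (p - 1) - 1 ∧ α + vL ≠ 2 * k)
    {x y : ℚ} (hx : x = a / ((p ^ k * e' : ℕ) : ℚ) ^ 2) (hy : y = b / ((p ^ k * e' : ℕ) : ℚ) ^ 3)
    (h : W.toAffine.Nonsingular x y) :
    ∀ (Dq : TateParameterData W p) (Dh : PAdicHeightData W p),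
      IsSplitMultCanonical Dh Dq → SchneiderConjecture Dh :=
  RegMult.schneiderHalf_split_of_cert hr (certSplit_of_row_padic hp5 W hW hWm H hx hy h)

end RowChecker

end Summit.BirchSwinnertonDyer.Rank1Residual.X11b.RegMult.HeightLogNumerator

end
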